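import Summits.BirchSwinnertonDyer.Rank1Residual.GaloisImage.MultiplicativeInertiaFixedPoints
import Summits.BirchSwinnertonDyer.Rank1Residual.X11b.MultiplicativeSurjectivity
import Literature.NumberTheory.EllipticCurves.NeronOggShafarevichLocal
import HarnessLib

/-!
# BSD rank-≤1 residual cell: at a MULTIPLICATIVE odd prime `p` with `p ∤ ord_p(Δ_min)`,
# `E[p]` irreducible ⟹ `ρ̄_{E,p}` SURJECTIVE — second (fixed-point) route, and the per-pair
# CONSUMERS with no image hypothesis (`MultDivisibilityAt`, the `p`-adic certificate, class X11)

HONEST FRAMING (cell `b2b-bsdres-*`, run/shared/lean/b2b/bsd-rank1-residual/, verbatim): the goal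
of the cell is to DELETE the COMBINATION-SHAPED residual classes for ALL analytic-rank `≤ 1` elliptic
curves over `ℚ` — "full BSD formula for every rank `≤ 1` curve in class C" assembled STRICTLY from
published theorems — so that the rank-`≤ 1` remainder becomes exactly the CONSTRUCTION-SHAPED
classes, which are TYPED (missing-input Props), NOT attempted; this is not "finishing BSD".
Prove what is provable now; shrink each hard class to its core with data; no claim beyond stated
classes. Unit `b2b-bsdres-x11c` (gen 8). Theorems only (no definition, no named fact); NO label
changes (X11a / X11b keep their labels); nothing booked.

PRIMARY ROUTE (sub-cell `multr1-p2`, gen 8, landed while this file was written):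
`X11b/MultiplicativeSurjectivity.lean` — `GaloisImage.surj_of_mult_of_irr_of_not_dvd`
(`Mult ∧ Irr ∧ p ∤ ord_p Δ_min ⟹ Surj`, `p` odd, globally minimal `E/ℚ`) from the TRANSVECTION in
the inertia group at `p` (`Literature/…/MultiplicativeReductionTransvectionProofs.lean`, Silverman
*ATAEC* V.6 Prop. 6.1 at `ℓ = p`) + Serre Prop. 15.  This file does NOT restate it; it adds:

* **`surj_of_mult_of_irr_of_not_dvd_ordMinimalDiscriminant`** — the PLACE form (`v` the place of
  `𝓞 ℚ` above `p`, hypothesis `¬ p ∣ W.ordMinimalDiscriminant v`, no `IsGloballyMinimal` instance),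
  by an INDEPENDENT second route: if `ρ̄` is not onto then `p ∤ #ρ̄(Γ_ℚ)` (Prop. 15,
  `not_dvd_card_of_not_hasSurjectiveModNGaloisRep`), so the inertia group at a prime `𝔏 ∣ p` of `ℚ̄`
  acts through a split half-Cartan subgroup `P (1 0; 0 *) P⁻¹` (gen 7,
  `exists_halfSplitCartan_eq_inertia_image_of_mult`) and FIXES `P e₁ ≠ 0`; with `𝔏` below the
  embedding `ℚ̄ → ℚ̄_p` the local inertia `I_𝔐 ≤ Γ_{ℚ_p}` lands in `I_𝔏`
  (`resGalOfEmb_mem_inertia_primeBelow`), contradicting `E[p]^{I_p} = 0`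
  (`eq_zero_of_forall_inertia_smul_eq_of_hasMultiplicativeReductionAt_of_not_dvd`,
  `MultiplicativeInertiaFixedPoints.lean`, Serre 1972 §1.12 valuation half).  Two kernel routes to
  the same classical fact; consumers should use the primary name.
* `ClassX11.surj_of_not_dvd` — the tree's v3 class X11 (`Mult ∧ Irr ∧ …`) at odd `p`.
* **`X11b.multDivisibilityAt_of_not_dvd`** — at a multiplicative `p ≥ 5` with `p ∤ ord_p(Δ_min)`
  the unit's typed input `MultDivisibilityAt W p` (gen 5) follows from the TWO published
  divisibilities with NO image hypothesis (reducible ⇒ `h16` Greenberg–Vatsal/Wuthrich Thm. 16;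
  irreducible ⇒ surjective ⇒ `hK` Kato–Wuthrich), as gen 7 did at `p ≥ 11`; hence the composed
  certificate consumers `X11b.bsdp_of_certificate_{split,nonsplit}_of_not_dvd`: published facts +
  the two-number `p`-adic certificate + `p ∤ #Ш_an` + ONE integer check ⟹ `BSD(E,p)`, either
  rank `≤ 1`, no Galois-image / (ram) / semistability hypothesis.  Per pair; not class theorems.

Census (gen 8, `code/b2b-bsdres-x11c/gen8/valscan.py`, Cremona `N < 5·10⁵`, all curves, odd
`p ∥ N`, `E[p]` irreducible): the `972` non-surjective pairs (`842` at `p = 3`, `130` at `p = 5`,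
none at `p ≥ 7`) ALL have `p ∣ ord_p Δ_min` (0 exceptions, as the theorem demands); `p ∤ ord_p Δ_min`
holds on `76.4 % / 91.8 % / 97.5 %` of the irreducible multiplicative pairs at `p = 3 / 5 / 7`, and
on `80 % / 93 % / 98 %` of those WITHOUT a (ram) prime (where `surj_of_irr_of_ram` is silent).

## References

* [SerreInventiones1972] J.-P. Serre, Invent. Math. 15 (1972), §1.12 (Cor. of Prop. 13), §2.1 a),
  §2.4 Prop. 15.
* [SilvermanATAEC1994] J. H. Silverman, *Advanced Topics*, V.4, Cor. IV.9.2(d), V.6 Prop. 6.1.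
* [Wuthrich2014] C. Wuthrich, Doc. Math. 19 (2014), Thm. 3 / Cor. 19, Thm. 16.
* [SteinWuthrich2013] W. Stein, C. Wuthrich, Math. Comp. 82 (2013), Thm. 6.1, §3.1, §4.2.
-/

noncomputable section

open scoped Classical NumberField NNReal
open IsDedekindDomain Field Matrix NumberField
open WeierstrassCurve Literature.NumberTheory.EllipticCurves Literature.NumberTheory.GaloisRepresentations
  Literature.NumberTheory.GaloisRepresentations.Serre1972 Rat.HeightOneSpectrum
  Literature.NumberTheory.EllipticCurves.Rank1Residual

namespace Summit.BirchSwinnertonDyer.Rank1Residual.GaloisImage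

variable (W : WeierstrassCurve ℚ) [W.IsElliptic] (p : ℕ) [hp : Fact p.Prime]

/-! ### Surjectivity from `Irr` and `p ∤ ord_p(Δ_min)` -/

/-- **`Mult ∧ Irr ∧ p ∤ ord_v(Δ_min) ⟹ Surj` at every odd prime `p`** (place form: `v` the place
of `𝓞 ℚ` above `p`).  If `ρ̄_{E,p}` were not onto, `p ∤ #ρ̄(Γ_ℚ)` (Serre Prop. 15, `Irr`, `det` onto:
`not_dvd_card_of_not_hasSurjectiveModNGaloisRep`), so inertia at `𝔏 ∣ p` is a split half-Cartan
subgroup `P (1 0; 0 *) P⁻¹` (`exists_halfSplitCartan_eq_inertia_image_of_mult`) fixing `P e₁ ≠ 0`;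
with `𝔏` the prime below the embedding `ℚ̄ → ℚ̄_p`, the local inertia `I_𝔐 ≤ Γ_{ℚ_p}` lands in
`I_𝔏` (`resGalOfEmb_mem_inertia_primeBelow`) and fixes `P e₁`, contradicting `E[p]^{I_p} = 0`
(`eq_zero_of_forall_inertia_smul_eq_of_hasMultiplicativeReductionAt_of_not_dvd`, `p ∤ ord_p Δ_min`,
`𝔪_v = (p)`). [cite: SerreInventiones1972, §1.12 (Cor. of Prop. 13), §2.1 a), §2.4 Prop. 15]
[cite: SilvermanATAEC1994, V.4 Lemmas 4.1.1–4.1.4 and Cor. IV.9.2(d)] -/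
theorem surj_of_mult_of_irr_of_not_dvd_ordMinimalDiscriminant (hp2 : p ≠ 2) (hmult : Mult W p)
    (hirr : Irr W p) {v : HeightOneSpectrum (𝓞 ℚ)} (hv : (primesEquiv v : ℕ) = p)
    (hn : ¬ p ∣ W.ordMinimalDiscriminant v) : Surj W p := by
  have hpp : p.Prime := hp.out
  by_contra hns
  set ρ := galoisRepTorsion W p with hρ
  obtain ⟨e, Φ, he, -⟩ := exists_frame_galoisRepTorsion_rat W p
  have hpG : ¬ p ∣ Nat.card (ρ.range.map Φ.toMonoidHom) :=
    not_dvd_card_of_not_hasSurjectiveModNGaloisRep W p Φ e he hirr hns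
  -- `p ∈ v`
  have hpv : (p : 𝓞 ℚ) ∈ v.asIdeal := by
    have hgen : natGenerator v = p := hv
    have h := (natGenerator_dvd_iff v).mp dvd_rfl
    rw [← map_natCast (Rat.IsIntegralClosure.intEquiv (𝓞 ℚ)), Ideal.apply_mem_of_equiv_iff] at h
    rwa [hgen] at h
  -- multiplicative reduction at the place `v`
  have hmult' : haveI := Fact.mk (primesEquiv v).2
      W.HasMultiplicativeReductionAtPrime (primesEquiv v) := by
    have key : ∀ (q : ℕ) (hq : Fact q.Prime), q = p →
        @WeierstrassCurve.HasMultiplicativeReductionAtPrime W q hq := by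
      rintro q hq rfl; exact hmult
    exact key _ _ hv
  have hmultv : W.HasMultiplicativeReductionAt v :=
    (W.hasMultiplicativeReductionAtPrime_iff_hasMultiplicativeReductionAt_ringOfIntegers v).mp hmult'
  -- the local data at `v`: spectral valuation, local prime `𝔐`, the global prime `𝔏` below `ℚ̄ → ℚ̄_p`
  obtain ⟨w, hw⟩ := v.exists_spectralValuation
  obtain ⟨𝔐, h𝔐⟩ := v.localPrimesAbove_nonempty
  set ι := closureEmb (K := ℚ) (v.adicCompletion ℚ) with hι
  have h𝔏 : v.primeBelow ι 𝔐 ∈ v.primesAbove :=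
    HeightOneSpectrum.primeBelow_mem_primesAbove (ι := ι) h𝔐
  -- inertia at `𝔏` is a split half-Cartan subgroup `P (1 0; 0 *) P⁻¹`
  obtain ⟨Pm, hPm⟩ :=
    exists_halfSplitCartan_eq_inertia_image_of_mult W p Φ e he hp2 hmult hpG hv h𝔏
  -- the fixed vector `P e₁`
  set e₀ : Fin 2 → ZMod p := Pi.single 0 1 with he₀
  set x : geomTorsion W p := e.symm (((Pm : GL (Fin 2) (ZMod p)) :
    Matrix (Fin 2) (Fin 2) (ZMod p)) *ᵥ e₀) with hxdef
  have hex : e x = ((Pm : GL (Fin 2) (ZMod p)) : Matrix (Fin 2) (Fin 2) (ZMod p)) *ᵥ e₀ := by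
    rw [hxdef, AddEquiv.apply_symm_apply]
  have hx0 : x ≠ 0 := by
    intro h0
    have h1 : ((Pm : GL (Fin 2) (ZMod p)) : Matrix (Fin 2) (Fin 2) (ZMod p)) *ᵥ e₀ = 0 := by
      rw [← hex, h0, map_zero]
    have h2 : e₀ = 0 := by
      have := congrArg (fun y ↦ ((Pm⁻¹ : GL (Fin 2) (ZMod p)) :
        Matrix (Fin 2) (Fin 2) (ZMod p)) *ᵥ y) h1
      simpa only [Matrix.mulVec_mulVec, ← Units.val_mul, inv_mul_cancel, Units.val_one,
        Matrix.one_mulVec, Matrix.mulVec_zero] using this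
    have h3 := congrFun h2 0
    rw [he₀, Pi.single_eq_same, Pi.zero_apply] at h3
    exact one_ne_zero h3
  have hxfix : ∀ τ ∈ (v.primeBelow ι 𝔐).inertia (absoluteGaloisGroup ℚ), τ • x = x := by
    intro τ hτ
    have hmem : Φ (ρ τ) ∈ halfSplitCartan Pm := by
      rw [← hPm]
      exact ⟨ρ τ, ⟨τ, hτ, rfl⟩, rfl⟩
    obtain ⟨⟨h01, h10⟩, h00⟩ := mem_halfSplitCartan_iff.mp hmem
    set D : GL (Fin 2) (ZMod p) := Pm⁻¹ * Φ (ρ τ) * Pm with hD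
    have hgD : Φ (ρ τ) = Pm * D * Pm⁻¹ := by rw [hD]; group
    have hDe₀ : ((D : GL (Fin 2) (ZMod p)) : Matrix (Fin 2) (Fin 2) (ZMod p)) *ᵥ e₀ = e₀ := by
      ext i
      fin_cases i <;>
        simp [Matrix.mulVec, dotProduct, Fin.sum_univ_two, he₀, h00, h10]
    apply e.injective
    change e (Multiplicative.toAdd (ρ τ) x) = e x
    rw [he, hex, hgD, Units.val_mul, Units.val_mul, ← Matrix.mulVec_mulVec,
      ← Matrix.mulVec_mulVec, Matrix.mulVec_mulVec _ (((Pm⁻¹ : GL (Fin 2) (ZMod p)) :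
        Matrix (Fin 2) (Fin 2) (ZMod p))), ← Units.val_mul, inv_mul_cancel, Units.val_one,
      Matrix.one_mulVec, hDe₀]
  -- local inertia restricts into `I_𝔏`, so fixes `x`
  have hfixloc : ∀ τ ∈ 𝔐.inertia (absoluteGaloisGroup (v.adicCompletion ℚ)),
      absGaloisRestrict ℚ (v.adicCompletion ℚ) τ • x = x := by
    intro τ hτ
    have hmem := HeightOneSpectrum.resGalOfEmb_mem_inertia_primeBelow v ι 𝔐 hτ
    rw [hι, ← resGal_eq, resGal_eq_absGaloisRestrict] at hmem
    exact hxfix _ hmem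
  exact hx0 (eq_zero_of_forall_inertia_smul_eq_of_hasMultiplicativeReductionAt_of_not_dvd W p hp2
    v hpv hmultv hn (natCast_dvd_of_mem_maximalIdeal_of_primesEquiv_eq p hv) hw h𝔐 hfixloc)

end Summit.BirchSwinnertonDyer.Rank1Residual.GaloisImage

/-! ### Class corollaries (labels unchanged) -/

namespace Summit.BirchSwinnertonDyer.Rank1Residual

open GaloisImage

variable (W : WeierstrassCurve ℚ) [W.IsElliptic] [W.IsGloballyMinimal] (p : ℕ) [hp : Fact p.Prime]

/-- **The tree's v3 class X11 with `p` odd and `p ∤ ord_p(Δ_min)`: `ρ̄_{E,p}` is onto**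
(`ClassX11 = Mult ∧ Irr ∧ (…)`). [cite: SerreInventiones1972, §1.12 (Cor. of Prop. 13), §2.4 Prop. 15] -/
theorem ClassX11.surj_of_not_dvd (hp2 : p ≠ 2) (hX : ClassX11 W p)
    (hn : ¬ p ∣ padicValInt p W.minimalDiscriminantInt) : Surj W p :=
  surj_of_mult_of_irr_of_not_dvd W p hp2 hX.1 hX.2.1 hn

end Summit.BirchSwinnertonDyer.Rank1Residual

/-! ### The unit's typed divisibility input needs no image hypothesis when `p ∤ ord_p(Δ_min)` -/

namespace Summit.BirchSwinnertonDyer.Rank1Residual.X11b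

open scoped MatrixGroups ModularForm
open GaloisImage CongruenceSubgroup Literature.NumberTheory.EllipticCurves.ModularForms
  Literature.NumberTheory.EllipticCurves.Rank1Residual.Typed
  Literature.NumberTheory.EllipticCurves.Wuthrich2014
  Literature.NumberTheory.EllipticCurves.SteinWuthrich2013

variable {W : WeierstrassCurve ℚ} [W.IsElliptic] [W.IsGloballyMinimal] {p : ℕ} [hp : Fact p.Prime]

/-- **`MultDivisibilityAt W p` from the TWO published divisibilities alone at a multiplicative `p ≥ 5`
with `p ∤ ord_p(Δ_min)`, with NO hypothesis on `ρ̄_{E,p}`.**  Case split on `E[p]`: reducible ⇒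
Greenberg–Vatsal / Wuthrich 2014 Thm. 16 (`h16`, `multDivisibilityAt_of_red`); irreducible ⇒
SURJECTIVE (`surj_of_mult_of_irr_of_not_dvd`, tree theorems only) ⇒ Kato–Wuthrich (`hK`,
`multDivisibilityAt_of_surj`).  So the gen-5 typed Prop is a genuine (unpublished) input only at the
pairs `Irr ∧ ¬Surj` — which all have `p ∣ ord_p(Δ_min)` (and `p ∈ {5, 7}`).  Per pair; NOT a class
theorem; X11b's label unchanged. [cite: Wuthrich2014, Thm. 3 / Cor. 19 and Thm. 16]
[cite: SerreInventiones1972, §1.12 (Cor. of Prop. 13), §2.4 Prop. 15] -/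
theorem multDivisibilityAt_of_not_dvd (h16 : thm16_charIdeal_dvd_multiplicative_of_reducible)
    (hK : kato_charIdeal_dvd_multiplicative_of_surjective) (hp5 : 5 ≤ p) (hmult : Mult W p)
    (hn : ¬ p ∣ padicValInt p W.minimalDiscriminantInt) : MultDivisibilityAt W p := by
  by_cases hirr : Irr W p
  · exact multDivisibilityAt_of_surj hK hp5 hmult
      (surj_of_mult_of_irr_of_not_dvd W p (by omega) hmult hirr hn)
  · exact multDivisibilityAt_of_red h16 (by omega) hmult hirr

/-- **At a multiplicative `p ≥ 5` with `p ∤ ord_p(Δ_min)`, analytic rank `≤ 1`, SPLIT case: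
PUBLISHED facts + the two-number `p`-adic certificate + `p ∤ #Ш_an` ⟹ `BSD(E,p)` — no hypothesis on
`ρ̄_{E,p}`, no (ram) prime, no semistability, either rank.**
`bsdp_of_multDivisibilityAt_split_of_certificate` with its only non-published, non-computational input
`MultDivisibilityAt W p` discharged by `multDivisibilityAt_of_not_dvd`.  Per pair (the certificate is
per pair); NOT a class theorem; labels unchanged. [cite: SteinWuthrich2013, Thm. 6.1 (p. 20) and §4.2]
[cite: Wuthrich2014, Thm. 3 / Cor. 19 and Thm. 16] -/
theorem bsdp_of_certificate_split_of_not_dvd (hJ : thm61_splitMultiplicative)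
    (hH : exists_isSplitMultCanonical) (hGZK : rank_eq_analyticRank_of_analyticRank_le_one)
    (h16 : thm16_charIdeal_dvd_multiplicative_of_reducible)
    (hK : kato_charIdeal_dvd_multiplicative_of_surjective)
    (W : WeierstrassCurve ℚ) [W.IsElliptic] [W.IsGloballyMinimal] (p : ℕ) [Fact p.Prime]
    {κ : ZpExtension ℚ p} {γ : Field.absoluteGaloisGroup ℚ} {N : ℕ} [NeZero N]
    {f : CuspForm (Gamma0 N) 2} (hp5 : 5 ≤ p) (hmult : Mult W p)
    (hn : ¬ p ∣ padicValInt p W.minimalDiscriminantInt) (hr : W.analyticRank ≤ 1)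
    (Dq : TateParameterData W p)
    (hκ : κ.IsCyclotomic) (hγ : κ.IsTopGenerator γ) (hγ' : IsCyclotomicVariable p γ)
    (hf : IsNewformOf W f) (D : W.SelmerDualData κ γ) (ϖ : ℚ) (hϖ0 : ϖ ≠ 0)
    (hϖ : (ϖ : ℝ) * W.realPeriodRat = plusPeriod f)
    (L : PowerSeries ℚ_[p]) (hL : IsSplitMultPAdicLFunctionOf f p L)
    (hordL : L.order = (W.mordellWeilRank + 1 : ℕ))
    (hcert : ∀ Dh : PAdicHeightData W p, IsSplitMultCanonical Dh Dq →
      (((ϖ : ℚ) : ℚ_[p]) * PowerSeries.coeff (W.mordellWeilRank + 1) L *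
          (padicLog p (cyclotomicGenerator p) ^ (W.mordellWeilRank + 1) *
            (W.torsionOrder : ℚ_[p]) ^ 2)).valuation =
        (LInvariant Dq * (W.tamagawaProduct : ℚ_[p]) * padicRegulator Dh).valuation)
    {s : ℚ} (hs : shaAn W = (s : ℂ)) (hv : padicValRat p s = 0) : BSDp W p :=
  bsdp_of_multDivisibilityAt_split_of_certificate hJ hH hGZK W p (by omega) hr
    (multDivisibilityAt_of_not_dvd h16 hK hp5 hmult hn) Dq hκ hγ hγ' hf D ϖ hϖ0 hϖ L hL hordL
    hcert hs hv

/-- **The same, NON-split multiplicative `p ≥ 5` with `p ∤ ord_p(Δ_min)`** (`e = 0`, `ε_p = 2`).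
Per pair; labels unchanged. [cite: SteinWuthrich2013, Thm. 6.1 (p. 20), §3.1 (p. 9) and §4.2]
[cite: Wuthrich2014, Thm. 3 / Cor. 19 and Thm. 16] -/
theorem bsdp_of_certificate_nonsplit_of_not_dvd (hJ : thm61_nonsplitMultiplicative)
    (hH : exists_isMultCanonical) (hGZK : rank_eq_analyticRank_of_analyticRank_le_one)
    (h16 : thm16_charIdeal_dvd_multiplicative_of_reducible)
    (hK : kato_charIdeal_dvd_multiplicative_of_surjective)
    (W : WeierstrassCurve ℚ) [W.IsElliptic] [W.IsGloballyMinimal] (p : ℕ) [Fact p.Prime]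
    {κ : ZpExtension ℚ p} {γ : Field.absoluteGaloisGroup ℚ} {N : ℕ} [NeZero N]
    {f : CuspForm (Gamma0 N) 2} (hp5 : 5 ≤ p) (hmult : Mult W p)
    (hn : ¬ p ∣ padicValInt p W.minimalDiscriminantInt) (hr : W.analyticRank ≤ 1)
    (hns : ¬ W.HasSplitMultiplicativeReductionAtPrime p)
    {q : ℚ_[p]} (hq0 : q ≠ 0) (hq1 : ‖q‖ < 1) (hqj : tateJ q = (W.j : ℚ_[p]))
    (hκ : κ.IsCyclotomic) (hγ : κ.IsTopGenerator γ) (hγ' : IsCyclotomicVariable p γ)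
    (hf : IsNewformOf W f) (D : W.SelmerDualData κ γ) (ϖ : ℚ) (hϖ0 : ϖ ≠ 0)
    (hϖ : (ϖ : ℝ) * W.realPeriodRat = plusPeriod f)
    (L : PowerSeries ℚ_[p]) (hL : IsMultPAdicLFunctionOf f p (-1) L)
    (hordL : L.order = (W.mordellWeilRank : ℕ))
    (hcert : ∀ Dh : PAdicHeightData W p, IsMultCanonical Dh q →
      (((ϖ : ℚ) : ℚ_[p]) * PowerSeries.coeff W.mordellWeilRank L *
          (padicLog p (cyclotomicGenerator p) ^ W.mordellWeilRank *
            (W.torsionOrder : ℚ_[p]) ^ 2)).valuation =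
        (2 * (W.tamagawaProduct : ℚ_[p]) * padicRegulator Dh).valuation)
    {s : ℚ} (hs : shaAn W = (s : ℂ)) (hv : padicValRat p s = 0) : BSDp W p :=
  bsdp_of_multDivisibilityAt_nonsplit_of_certificate hJ hH hGZK W p (by omega) hr
    (multDivisibilityAt_of_not_dvd h16 hK hp5 hmult hn) hmult hns hq0 hq1 hqj hκ hγ hγ' hf D ϖ
    hϖ0 hϖ L hL hordL hcert hs hv

end Summit.BirchSwinnertonDyer.Rank1Residual.X11b

end
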